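import Summits.ResolutionOfSingularities.ResolutionOfSingularities.Theorems.FrobeniusLadderFInjectiveMacaulayficationX2CyclicCubicChar2
import Summits.ResolutionOfSingularities.ResolutionOfSingularities.Theorems.FrobeniusLadderFInjectiveMacaulayficationX2TwoCubesVertexFull
import HarnessLib

/-!
# THE CYCLIC CUBIC `x² + Y₀²Y₁ + Y₁²Y₂ + Y₂²Y₃ + Y₃²Y₀` AT `p = 3`: vertex (indeed every closed point) FULL, isolated, chart cubics smooth — hence T″-INSTANCE #4 AT `p = 3`, a
# non-Fermat kernel instance of the T-side class row ON A FULL INPUT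
# (crux `FInjectiveMacaulayfication` stmt-ResolutionOfSingularities-15315, chain w45a; res-L1-w45a-plan-1 CORRECTION to R22.20 (a) «The cyclic cubic BECOMES T″-instance #4 at p = 3
# (vertex x² + cyclic IS F-pure there, tri-2) once an input-FULLness certificate lands: object `cyclic_vertex_full_char3` + `cyclic_tStep_row_char3` (S) — stub-1 g14 after
# (B‴)»; seat res-L1-w45a-stub-1 g14; sequel of ✓ `…X2CyclicCubicChar2` (primes characteristic-free) and of res-L1-w45a-lead-1's ✓ `X2CubicFormTStepRow` / ✓ `X2TwoCubesVertexFull`)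

[OURS · L1 W4.5a] Support file (`--supports stmt-ResolutionOfSingularities-15315 --as helper`); def-free; UNCONDITIONAL; no named fact; NOT a statement of any manuscript. HONEST
BILLING: one more INSTANCE of the T-side class row (transversal-A₁ cubic-surface regime), with its input-FULLness — evidence for nothing beyond that regime; T″ is not narrowed;
nothing of the crux is proved. AI-written (AI review is weaker than expert review).

Letters: `F = Y₀²Y₁ + Y₁²Y₂ + Y₂²Y₃ + Y₃²Y₀`, `f = X₄² + F(X₀..X₃)`, `Y = Spec k[X]/(f)`, `v` the vertex; chart cubics `w₀ = Z₀ + Z₀²Z₁ + Z₁²Z₂ + Z₂² = w₃`, `w₁ = w₀(Z₁,Z₂,Z₀)`,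
`w₂ = w₀(Z₂,Z₀,Z₁)` (✓ `X2CyclicCubicChar2.dehomogenisation_cyclic`).
* §1 (any `k`) `pderiv_ofNat`, the first partials `pderiv_four_f` (`2X₄`), `pderiv_zero_f` … `pderiv_three_f` (`2Y_iY_{i+1} + Y_{i−1}²`), and the DERIVATIVE CHAIN
  `iterPderiv_f_sq : ∂₀∂₀∂₁∂₄∂₄(f²) = 8` (only the monomial `2X₄²·Y₀²Y₁` of `f²` survives).
* §2 (`char k = 3`) ★ `hcert_cyclic_char3` (every `∂`-stable set containing `f²` contains `8 = 2 ≠ 0`, hence generates `(1)`), ★ `fullCl_stalk_cyclic_char3` (`Y` is FULL AT EVERY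
  CLOSED POINT — res-L1-w45a-lead-1's engine ✓ `TCaFloorOneFull.clause_at_maximal_of_derivative_certificate`), ★ `cyclic_vertex_full_char3 : FullCl 3 (𝒪_{Y,v})`.
* §3 (`2, 5 ≠ 0` in `k`) ★ `regular_off_vertex_of_ne` — `Y` is regular off the vertex whenever `2 ≠ 0` and `5 ≠ 0`: at a prime `P ⊉ 𝔪` with all `∂ᵢf ∈ P` one gets `X₄ ∈ P`, then
  `F ∈ P` and the identity `F + 5·Y₀²Y₁ = 3Y₀·∂₀F + Y₂·∂₂F − Y₃·∂₃F` forces `Y₀²Y₁ ∈ P`, and the partials `2Y_iY_{i+1} + Y_{i−1}²` propagate `Y_j ∈ P` around the cycle —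
  excluded. (At `p = 5` the cone IS singular off the vertex: `(1, ζ⁴, ζ, ζ²)`, `ζ⁵ = 1`.)
* §4 (`char k = 3`) ★ `smooth_chartCubic_char3` — one Jacobian certificate per chart: `Z₁·w₀ + ∂₀w₀ − Z₁²·∂₁w₀ + Z₁Z₂·∂₂w₀ = 1 + 3(Z₀Z₁ + Z₁Z₂²)` and its two cyclic renamings
  (✓ `X2CubicFormSmoothCert.smooth_of_jacobian_certificate`).
* §5 ★★ `cyclic_tStep_row_char3` (SCOPE ∧ point floor LEGAL and FULL at every stalk ∧ `TStepGerm.TStepInstanceAt 3 v 𝔪̃`, one application of ✓ `tStep_row_of_doublePoint_cubicForm`)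
  and ★★ `cyclic_tInstance_char3 : FullCl 3 (𝒪_{Y,v}) ∧ (that row)` — T″-instance #4: a FULL, closed, singular, isolated point of a non-Fermat bed at `p = 3` whose point floor is
  regularised by one blowing up along its reduced singular locus.
[folklore mathematics, OURS as a certificate; cite: Fedder1983, Thm. 1.12; Hartshorne1977, I Thm. 5.1; StacksProject, Tag 07PF]
-/

-- single-problem summit: the doubled namespace component is forced
set_option linter.dupNamespace false

noncomputable section

namespace Summit.ResolutionOfSingularities.ResolutionOfSingularities.Theorems.FInjectiveMacaulayfication.X2CyclicCubicChar3

open CategoryTheory CategoryTheory.Limits AlgebraicGeometry TopologicalSpace IsLocalRing MvPolynomial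
open Literature.AlgebraicGeometry.Resolution
open Summit.ResolutionOfSingularities.ResolutionOfSingularities.Theorems.FInjectiveMacaulayfication
open SliceableCentre X2CyclicCubicChar2

variable (k : Type) [Field k]

/-! ## §1 Characteristic-free derivative computations -/

/-- Partial derivatives kill numerals. [plumbing] -/
theorem pderiv_ofNat {n : ℕ} (i : Fin n) (m : ℕ) [m.AtLeastTwo] : pderiv i (OfNat.ofNat m : MvPolynomial (Fin n) k) = 0 := by
  rw [← map_ofNat (C : k →+* MvPolynomial (Fin n) k) m, pderiv_C]

/-- `∂₄ f = 2X₄`. [elementary] -/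
theorem pderiv_four_f (f : MvPolynomial (Fin 5) k)
    (hf : f = X 4 ^ 2 + rename (Fin.castSucc : Fin 4 → Fin 5) (X 0 ^ 2 * X 1 + X 1 ^ 2 * X 2 + X 2 ^ 2 * X 3 + X 3 ^ 2 * X 0 : MvPolynomial (Fin 4) k)) :
    pderiv 4 f = 2 * X 4 := by
  rw [f_eq k f hf]
  simp only [map_add, Derivation.leibniz, Derivation.leibniz_pow, pderiv_X_self, smul_eq_mul, nsmul_eq_mul,
    pderiv_X_of_ne (show (0 : Fin 5) ≠ 4 by decide), pderiv_X_of_ne (show (1 : Fin 5) ≠ 4 by decide), pderiv_X_of_ne (show (2 : Fin 5) ≠ 4 by decide),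
    pderiv_X_of_ne (show (3 : Fin 5) ≠ 4 by decide)]
  push_cast
  ring

/-- `∂₀ f = 2X₀X₁ + X₃²`, `∂₁ f = X₀² + 2X₁X₂`, `∂₂ f = X₁² + 2X₂X₃`, `∂₃ f = X₂² + 2X₃X₀`. [elementary] -/
theorem pderiv_cube_f (f : MvPolynomial (Fin 5) k)
    (hf : f = X 4 ^ 2 + rename (Fin.castSucc : Fin 4 → Fin 5) (X 0 ^ 2 * X 1 + X 1 ^ 2 * X 2 + X 2 ^ 2 * X 3 + X 3 ^ 2 * X 0 : MvPolynomial (Fin 4) k)) :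
    pderiv 0 f = 2 * X 0 * X 1 + X 3 ^ 2 ∧ pderiv 1 f = X 0 ^ 2 + 2 * X 1 * X 2 ∧ pderiv 2 f = X 1 ^ 2 + 2 * X 2 * X 3 ∧ pderiv 3 f = X 2 ^ 2 + 2 * X 3 * X 0 := by
  rw [f_eq k f hf]
  refine ⟨?_, ?_, ?_, ?_⟩
  · simp only [map_add, Derivation.leibniz, Derivation.leibniz_pow, pderiv_X_self, smul_eq_mul, nsmul_eq_mul,
      pderiv_X_of_ne (show (1 : Fin 5) ≠ 0 by decide), pderiv_X_of_ne (show (2 : Fin 5) ≠ 0 by decide), pderiv_X_of_ne (show (3 : Fin 5) ≠ 0 by decide),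
      pderiv_X_of_ne (show (4 : Fin 5) ≠ 0 by decide)]
    push_cast
    ring
  · simp only [map_add, Derivation.leibniz, Derivation.leibniz_pow, pderiv_X_self, smul_eq_mul, nsmul_eq_mul,
      pderiv_X_of_ne (show (0 : Fin 5) ≠ 1 by decide), pderiv_X_of_ne (show (2 : Fin 5) ≠ 1 by decide), pderiv_X_of_ne (show (3 : Fin 5) ≠ 1 by decide),
      pderiv_X_of_ne (show (4 : Fin 5) ≠ 1 by decide)]
    push_cast
    ring
  · simp only [map_add, Derivation.leibniz, Derivation.leibniz_pow, pderiv_X_self, smul_eq_mul, nsmul_eq_mul,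
      pderiv_X_of_ne (show (0 : Fin 5) ≠ 2 by decide), pderiv_X_of_ne (show (1 : Fin 5) ≠ 2 by decide), pderiv_X_of_ne (show (3 : Fin 5) ≠ 2 by decide),
      pderiv_X_of_ne (show (4 : Fin 5) ≠ 2 by decide)]
    push_cast
    ring
  · simp only [map_add, Derivation.leibniz, Derivation.leibniz_pow, pderiv_X_self, smul_eq_mul, nsmul_eq_mul,
      pderiv_X_of_ne (show (0 : Fin 5) ≠ 3 by decide), pderiv_X_of_ne (show (1 : Fin 5) ≠ 3 by decide), pderiv_X_of_ne (show (2 : Fin 5) ≠ 3 by decide),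
      pderiv_X_of_ne (show (4 : Fin 5) ≠ 3 by decide)]
    push_cast
    ring

/-- ★ **THE DERIVATIVE CHAIN `∂₀∂₀∂₁∂₄∂₄(f²) = 8`** (characteristic-free): `∂₄∂₄(f²) = 4f + 8X₄²`, `∂₁` of that is `4X₀² + 8X₁X₂`, then `∂₀∂₀` gives `8` — only the monomial `2X₄²·X₀²X₁` of
`f²` survives. [elementary] -/
theorem iterPderiv_f_sq (f : MvPolynomial (Fin 5) k)
    (hf : f = X 4 ^ 2 + rename (Fin.castSucc : Fin 4 → Fin 5) (X 0 ^ 2 * X 1 + X 1 ^ 2 * X 2 + X 2 ^ 2 * X 3 + X 3 ^ 2 * X 0 : MvPolynomial (Fin 4) k)) :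
    pderiv 0 (pderiv 0 (pderiv 1 (pderiv 4 (pderiv 4 (f ^ 2))))) = 8 := by
  obtain ⟨d0, d1, -, -⟩ := pderiv_cube_f k f hf
  have d4 := pderiv_four_f k f hf
  have e1 : pderiv 4 (f ^ 2) = 4 * X 4 * f := by
    rw [pow_two, Derivation.leibniz, d4, smul_eq_mul]; ring
  have e2 : pderiv 4 (4 * X 4 * f) = 4 * f + 8 * X 4 ^ 2 := by
    rw [Derivation.leibniz, Derivation.leibniz, d4, pderiv_X_self, pderiv_ofNat, smul_eq_mul, smul_eq_mul, smul_eq_mul, smul_zero, add_zero]; ring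
  have e3 : pderiv 1 (4 * f + 8 * X 4 ^ 2 : MvPolynomial (Fin 5) k) = 4 * X 0 ^ 2 + 8 * X 1 * X 2 := by
    rw [map_add, Derivation.leibniz, Derivation.leibniz, d1, pderiv_ofNat, pderiv_ofNat, Derivation.leibniz_pow, pderiv_X_of_ne (show (4 : Fin 5) ≠ 1 by decide)]
    simp only [smul_eq_mul, smul_zero, add_zero, mul_zero]; ring
  have e4 : pderiv 0 (4 * X 0 ^ 2 + 8 * X 1 * X 2 : MvPolynomial (Fin 5) k) = 8 * X 0 := by
    rw [map_add, Derivation.leibniz, Derivation.leibniz, Derivation.leibniz, pderiv_ofNat, pderiv_ofNat, Derivation.leibniz_pow, pderiv_X_self,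
      pderiv_X_of_ne (show (1 : Fin 5) ≠ 0 by decide), pderiv_X_of_ne (show (2 : Fin 5) ≠ 0 by decide)]
    simp only [smul_eq_mul, nsmul_eq_mul, add_zero, mul_zero, mul_one]; push_cast; ring
  have e5 : pderiv 0 (8 * X 0 : MvPolynomial (Fin 5) k) = 8 := by
    rw [Derivation.leibniz, pderiv_ofNat, pderiv_X_self, smul_eq_mul, smul_zero, add_zero, mul_one]
  rw [e1, e2, e3, e4, e5]

/-! ## §2 Characteristic 3: every closed point is FULL -/

/-- ★ **THE DERIVATIVE CERTIFICATE AT `p = 3`**: every `∂`-stable set `T ∋ f^{3−1} = f²` contains `8 = 2`, a unit in characteristic 3, hence spans `(1)`. [OURS · certificate] -/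
theorem hcert_cyclic_char3 [CharP k 3] (f : MvPolynomial (Fin 5) k)
    (hf : f = X 4 ^ 2 + rename (Fin.castSucc : Fin 4 → Fin 5) (X 0 ^ 2 * X 1 + X 1 ^ 2 * X 2 + X 2 ^ 2 * X 3 + X 3 ^ 2 * X 0 : MvPolynomial (Fin 4) k)) :
    ∀ T : Set (MvPolynomial (Fin 5) k), f ^ (3 - 1) ∈ T → (∀ s ∈ T, ∀ i : Fin 5, pderiv i s ∈ T) → (1 : MvPolynomial (Fin 5) k) ∈ Ideal.span T := by
  intro T hT hcl
  have h8 : (8 : MvPolynomial (Fin 5) k) ∈ T := by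
    rw [← iterPderiv_f_sq k f hf]
    exact hcl _ (hcl _ (hcl _ (hcl _ (hcl _ (by simpa using hT) 4) 4) 1) 0) 0
  have h8k : (8 : k) ≠ 0 := by
    intro h
    have h3 : (3 : k) = 0 := by exact_mod_cast CharP.cast_eq_zero k 3
    have : (1 : k) = 0 := by linear_combination (-1 : k) * h + 3 * h3
    exact one_ne_zero this
  have hu : IsUnit (8 : MvPolynomial (Fin 5) k) := by
    rw [← map_ofNat (C : k →+* MvPolynomial (Fin 5) k) 8]
    exact (isUnit_iff_ne_zero.mpr h8k).map C
  exact (Ideal.eq_top_iff_one _).mp (Ideal.eq_top_of_isUnit_mem _ (Ideal.subset_span h8) hu)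

/-- ★ **`Y = {x² + cyclic cubic = 0}` IS FULL AT EVERY CLOSED POINT in characteristic 3** (domain, CM clause, parameter ideals Frobenius closed): res-L1-w45a-lead-1's engine
✓ `TCaFloorOneFull.clause_at_maximal_of_derivative_certificate` on `hcert_cyclic_char3`. [OURS · application; cite: Fedder1983, Thm. 1.12] -/
theorem fullCl_stalk_cyclic_char3 [CharP k 3] (f : MvPolynomial (Fin 5) k)
    (hf : f = X 4 ^ 2 + rename (Fin.castSucc : Fin 4 → Fin 5) (X 0 ^ 2 * X 1 + X 1 ^ 2 * X 2 + X 2 ^ 2 * X 3 + X 3 ^ 2 * X 0 : MvPolynomial (Fin 4) k))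
    (y : Spec (.of (MvPolynomial (Fin 5) k ⧸ Ideal.span {f}))) (hy : y.asIdeal.IsMaximal) :
    FullCl 3 ((Spec (.of (MvPolynomial (Fin 5) k ⧸ Ideal.span {f}))).presheaf.stalk y) := by
  haveI : Fact (Nat.Prime 3) := ⟨Nat.prime_three⟩
  have hprime := prime_f k f hf
  haveI := (Ideal.span_singleton_prime hprime.ne_zero).mpr hprime
  haveI : IsDomain (MvPolynomial (Fin 5) k ⧸ Ideal.span {f}) := Ideal.Quotient.isDomain _
  haveI := hy
  haveI : IsDomain (Localization.AtPrime y.asIdeal) :=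
    IsLocalization.isDomain_of_le_nonZeroDivisors _ y.asIdeal.primeCompl_le_nonZeroDivisors
  have hloc : FullCl 3 (Localization.AtPrime y.asIdeal) :=
    ⟨inferInstance, TCaFloorOneFull.clause_at_maximal_of_derivative_certificate 3 k f hprime.ne_zero (hcert_cyclic_char3 k f hf) y.asIdeal⟩
  exact WFixAtNonClosedDimTwo.fullCl_of_ringEquiv 3 (Spec.stalkIso (.of _) y).commRingCatIsoToRingEquiv.symm hloc

/-- ★ **THE VERTEX OF THE CYCLIC-CUBIC BED IS FULL AT `p = 3`** — the INPUT-FULLness that makes it a T″-instance. [OURS · application] -/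
theorem cyclic_vertex_full_char3 [CharP k 3] (f : MvPolynomial (Fin 5) k)
    (hf : f = X 4 ^ 2 + rename (Fin.castSucc : Fin 4 → Fin 5) (X 0 ^ 2 * X 1 + X 1 ^ 2 * X 2 + X 2 ^ 2 * X 3 + X 3 ^ 2 * X 0 : MvPolynomial (Fin 4) k))
    (v : Spec (.of (MvPolynomial (Fin 5) k ⧸ Ideal.span {f})))
    (hv : v.asIdeal = Ideal.span (Set.range fun j : Fin 5 => Ideal.Quotient.mk (Ideal.span {f}) (X j))) :
    FullCl 3 ((Spec (.of (MvPolynomial (Fin 5) k ⧸ Ideal.span {f}))).presheaf.stalk v) := by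
  refine fullCl_stalk_cyclic_char3 k f hf v ?_
  rw [hv]
  exact DoublePointFermatCubicGerm.isMaximal_origin k f (X2CubicFormFrontEnd.constantCoeff_f k _ (cyclic_isHomogeneous k) f hf)

/-! ## §3 Isolatedness whenever `2, 5 ≠ 0` -/

/-- The identity behind isolatedness: `F + 5·Y₀²Y₁ = 3Y₀·∂₀f + Y₂·∂₂f − Y₃·∂₃f` (`F = f − X₄²`). [elementary] -/
theorem five_mul_mem_identity (f : MvPolynomial (Fin 5) k)
    (hf : f = X 4 ^ 2 + rename (Fin.castSucc : Fin 4 → Fin 5) (X 0 ^ 2 * X 1 + X 1 ^ 2 * X 2 + X 2 ^ 2 * X 3 + X 3 ^ 2 * X 0 : MvPolynomial (Fin 4) k)) :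
    (f - X 4 ^ 2) + 5 * (X 0 ^ 2 * X 1) = 3 * X 0 * pderiv 0 f + X 2 * pderiv 2 f - X 3 * pderiv 3 f := by
  obtain ⟨d0, -, d2, d3⟩ := pderiv_cube_f k f hf
  rw [d0, d2, d3, f_eq k f hf]
  ring

/-- ★ **`Y` IS REGULAR OFF THE VERTEX whenever `2 ≠ 0` and `5 ≠ 0` in `k`** (so at `p = 3` and every `p ∉ {2, 5}`): Jacobian criterion; if all partials lay in a prime `P ⊉ 𝔪` containing
`f`, then `X₄ ∈ P` (`∂₄f = 2X₄`), `F ∈ P`, `Y₀²Y₁ ∈ P` (§3 identity), and the partials `2Y_iY_{i+1} + Y_{i−1}²` propagate membership around the cycle until `𝔪 ≤ P`.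
[cite: Hartshorne1977, I Thm. 5.1] -/
theorem regular_off_vertex_of_ne (h2 : (2 : k) ≠ 0) (h5 : (5 : k) ≠ 0) (f : MvPolynomial (Fin 5) k)
    (hf : f = X 4 ^ 2 + rename (Fin.castSucc : Fin 4 → Fin 5) (X 0 ^ 2 * X 1 + X 1 ^ 2 * X 2 + X 2 ^ 2 * X 3 + X 3 ^ 2 * X 0 : MvPolynomial (Fin 4) k))
    (P : Ideal (MvPolynomial (Fin 5) k ⧸ Ideal.span {f})) [P.IsPrime]
    (hP : ¬ Ideal.span (Set.range fun j : Fin 5 => Ideal.Quotient.mk (Ideal.span {f}) (X j)) ≤ P) :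
    IsRegularLocalRing (Localization.AtPrime P) := by
  have hP' : (P.comap (Ideal.Quotient.mk (Ideal.span {f}))).IsPrime := Ideal.comap_isPrime _ _
  set P' := P.comap (Ideal.Quotient.mk (Ideal.span {f})) with hP'def
  have hfP : f ∈ P' := by
    rw [hP'def, Ideal.mem_comap, Ideal.Quotient.eq_zero_iff_mem.mpr (Ideal.mem_span_singleton_self f)]
    exact P.zero_mem
  have hCne : ∀ c : k, c ≠ 0 → (C c : MvPolynomial (Fin 5) k) ∉ P' := fun c hc h =>
    hP'.ne_top ((Ideal.eq_top_iff_one _).mpr (by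
      have hu : IsUnit (C c : MvPolynomial (Fin 5) k) := (isUnit_iff_ne_zero.mpr hc).map C
      exact (Ideal.unit_mul_mem_iff_mem _ hu).mp (by simpa using h)))
  by_contra hnot
  -- every partial derivative lies in `P'`
  have hall : ∀ i : Fin 5, pderiv i f ∈ P' := fun i => by
    by_contra hi
    exact hnot (HypersurfaceRegular.stub_hypersurfaceRegularOfPderiv k 5 f i P hi)
  obtain ⟨d0, d1, d2, d3⟩ := pderiv_cube_f k f hf
  have d4 := pderiv_four_f k f hf
  -- the square-root steps along the cycle
  have hsq : ∀ q : MvPolynomial (Fin 5) k, q ^ 2 ∈ P' → q ∈ P' := fun q hq => hP'.mem_of_pow_mem 2 hq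
  have h4 : (X 4 : MvPolynomial (Fin 5) k) ∈ P' := by
    have h := hall 4
    rw [d4, show (2 : MvPolynomial (Fin 5) k) = C (2 : k) from (map_ofNat C 2).symm] at h
    exact ((hP'.mem_or_mem h).resolve_left (hCne 2 h2))
  have hF : f - X 4 ^ 2 ∈ P' := sub_mem hfP (Ideal.pow_mem_of_mem P' h4 2 (by norm_num))
  have h01 : (X 0 : MvPolynomial (Fin 5) k) ^ 2 * X 1 ∈ P' := by
    have h : (5 : MvPolynomial (Fin 5) k) * (X 0 ^ 2 * X 1) ∈ P' := by
      have e : (5 : MvPolynomial (Fin 5) k) * (X 0 ^ 2 * X 1) = (3 * X 0 * pderiv 0 f + X 2 * pderiv 2 f - X 3 * pderiv 3 f) - (f - X 4 ^ 2) := by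
        rw [← five_mul_mem_identity k f hf]; ring
      rw [e]
      exact sub_mem (sub_mem (add_mem (Ideal.mul_mem_left _ _ (hall 0)) (Ideal.mul_mem_left _ _ (hall 2))) (Ideal.mul_mem_left _ _ (hall 3))) hF
    rw [show (5 : MvPolynomial (Fin 5) k) = C (5 : k) from (map_ofNat C 5).symm] at h
    exact (hP'.mem_or_mem h).resolve_left (hCne 5 h5)
  -- from `X_i ∈ P'` and `∂_i f = 2X_iX_{i+1} + X_{i−1}² ∈ P'` we get `X_{i−1} ∈ P'`
  have step0 : (X 0 : MvPolynomial (Fin 5) k) ∈ P' → (X 3 : MvPolynomial (Fin 5) k) ∈ P' := fun h0 => by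
    refine hsq _ ?_
    have e : (X 3 : MvPolynomial (Fin 5) k) ^ 2 = pderiv 0 f - 2 * X 0 * X 1 := by rw [d0]; ring
    rw [e]; exact sub_mem (hall 0) (Ideal.mul_mem_right _ _ (Ideal.mul_mem_left _ _ h0))
  have step3 : (X 3 : MvPolynomial (Fin 5) k) ∈ P' → (X 2 : MvPolynomial (Fin 5) k) ∈ P' := fun h3 => by
    refine hsq _ ?_
    have e : (X 2 : MvPolynomial (Fin 5) k) ^ 2 = pderiv 3 f - 2 * X 3 * X 0 := by rw [d3]; ring
    rw [e]; exact sub_mem (hall 3) (Ideal.mul_mem_right _ _ (Ideal.mul_mem_left _ _ h3))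
  have step2 : (X 2 : MvPolynomial (Fin 5) k) ∈ P' → (X 1 : MvPolynomial (Fin 5) k) ∈ P' := fun h2' => by
    refine hsq _ ?_
    have e : (X 1 : MvPolynomial (Fin 5) k) ^ 2 = pderiv 2 f - 2 * X 2 * X 3 := by rw [d2]; ring
    rw [e]; exact sub_mem (hall 2) (Ideal.mul_mem_right _ _ (Ideal.mul_mem_left _ _ h2'))
  have step1 : (X 1 : MvPolynomial (Fin 5) k) ∈ P' → (X 0 : MvPolynomial (Fin 5) k) ∈ P' := fun h1 => by
    refine hsq _ ?_
    have e : (X 0 : MvPolynomial (Fin 5) k) ^ 2 = pderiv 1 f - 2 * X 1 * X 2 := by rw [d1]; ring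
    rw [e]; exact sub_mem (hall 1) (Ideal.mul_mem_right _ _ (Ideal.mul_mem_left _ _ h1))
  have h0 : (X 0 : MvPolynomial (Fin 5) k) ∈ P' := by
    rcases hP'.mem_or_mem h01 with h | h
    · exact hsq _ h
    · exact step1 h
  have h3 := step0 h0
  have h2m := step3 h3
  have h1 := step2 h2m
  apply hP
  rw [Ideal.span_le]
  rintro _ ⟨j, rfl⟩
  by_cases hj : j = 4
  · subst hj; exact h4
  · rcases X2Cubic4Specimen.eq_cube_index_of_ne_four j hj with rfl | rfl | rfl | rfl
    · exact h0
    · exact h1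
    · exact h2m
    · exact h3

/-! ## §4 Characteristic 3: the chart cubics are smooth -/

/-- ★ **In characteristic 3 every chart cubic is SMOOTH** — Jacobian certificates `Z₁·w₀ + ∂₀w₀ − Z₁²·∂₁w₀ + Z₁Z₂·∂₂w₀ = 1 + 3(Z₀Z₁ + Z₁Z₂²)` and its cyclic renamings for
`w₁ = w₀(Z₁,Z₂,Z₀)`, `w₂ = w₀(Z₂,Z₀,Z₁)` (✓ `X2CubicFormSmoothCert.smooth_of_jacobian_certificate`). [elementary; cite: StacksProject, Tag 07PF] -/
theorem smooth_chartCubic_char3 [CharP k 3] (a : Fin 4) (Q : Ideal (MvPolynomial (Fin 3) k)) (hQ : Q.IsPrime)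
    (hQa : MvPolynomial.aeval ((![![1, X 0, X 1, X 2], ![X 0, 1, X 1, X 2], ![X 0, X 1, 1, X 2], ![X 0, X 1, X 2, 1]] : Fin 4 → Fin 4 → MvPolynomial (Fin 3) k) a)
      (X 0 ^ 2 * X 1 + X 1 ^ 2 * X 2 + X 2 ^ 2 * X 3 + X 3 ^ 2 * X 0 : MvPolynomial (Fin 4) k) ∈ Q) :
    ∃ D : Derivation k (MvPolynomial (Fin 3) k) (MvPolynomial (Fin 3) k),
      D (MvPolynomial.aeval ((![![1, X 0, X 1, X 2], ![X 0, 1, X 1, X 2], ![X 0, X 1, 1, X 2], ![X 0, X 1, X 2, 1]] : Fin 4 → Fin 4 → MvPolynomial (Fin 3) k) a)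
        (X 0 ^ 2 * X 1 + X 1 ^ 2 * X 2 + X 2 ^ 2 * X 3 + X 3 ^ 2 * X 0 : MvPolynomial (Fin 4) k)) ∉ Q := by
  have h3 : (3 : MvPolynomial (Fin 3) k) = 0 := by
    have := CharP.cast_eq_zero (MvPolynomial (Fin 3) k) 3
    simpa using this
  rw [dehomogenisation_cyclic] at hQa ⊢
  -- the partial derivatives of the three chart cubics (characteristic-free computations)
  have d00 : pderiv 0 (X 0 + X 0 ^ 2 * X 1 + X 1 ^ 2 * X 2 + X 2 ^ 2 : MvPolynomial (Fin 3) k) = 1 + 2 * X 0 * X 1 := by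
    simp only [map_add, Derivation.leibniz, Derivation.leibniz_pow, pderiv_X_self, smul_eq_mul, nsmul_eq_mul,
      pderiv_X_of_ne (show (1 : Fin 3) ≠ 0 by decide), pderiv_X_of_ne (show (2 : Fin 3) ≠ 0 by decide)]
    push_cast; ring
  have d01 : pderiv 1 (X 0 + X 0 ^ 2 * X 1 + X 1 ^ 2 * X 2 + X 2 ^ 2 : MvPolynomial (Fin 3) k) = X 0 ^ 2 + 2 * X 1 * X 2 := by
    simp only [map_add, Derivation.leibniz, Derivation.leibniz_pow, pderiv_X_self, smul_eq_mul, nsmul_eq_mul,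
      pderiv_X_of_ne (show (0 : Fin 3) ≠ 1 by decide), pderiv_X_of_ne (show (2 : Fin 3) ≠ 1 by decide)]
    push_cast; ring
  have d02 : pderiv 2 (X 0 + X 0 ^ 2 * X 1 + X 1 ^ 2 * X 2 + X 2 ^ 2 : MvPolynomial (Fin 3) k) = X 1 ^ 2 + 2 * X 2 := by
    simp only [map_add, Derivation.leibniz, Derivation.leibniz_pow, pderiv_X_self, smul_eq_mul, nsmul_eq_mul,
      pderiv_X_of_ne (show (0 : Fin 3) ≠ 2 by decide), pderiv_X_of_ne (show (1 : Fin 3) ≠ 2 by decide)]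
    push_cast; ring
  have d10 : pderiv 0 (X 0 ^ 2 + X 1 + X 1 ^ 2 * X 2 + X 0 * X 2 ^ 2 : MvPolynomial (Fin 3) k) = 2 * X 0 + X 2 ^ 2 := by
    simp only [map_add, Derivation.leibniz, Derivation.leibniz_pow, pderiv_X_self, smul_eq_mul, nsmul_eq_mul,
      pderiv_X_of_ne (show (1 : Fin 3) ≠ 0 by decide), pderiv_X_of_ne (show (2 : Fin 3) ≠ 0 by decide)]
    push_cast; ring
  have d11 : pderiv 1 (X 0 ^ 2 + X 1 + X 1 ^ 2 * X 2 + X 0 * X 2 ^ 2 : MvPolynomial (Fin 3) k) = 1 + 2 * X 1 * X 2 := by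
    simp only [map_add, Derivation.leibniz, Derivation.leibniz_pow, pderiv_X_self, smul_eq_mul, nsmul_eq_mul,
      pderiv_X_of_ne (show (0 : Fin 3) ≠ 1 by decide), pderiv_X_of_ne (show (2 : Fin 3) ≠ 1 by decide)]
    push_cast; ring
  have d12 : pderiv 2 (X 0 ^ 2 + X 1 + X 1 ^ 2 * X 2 + X 0 * X 2 ^ 2 : MvPolynomial (Fin 3) k) = X 1 ^ 2 + 2 * X 0 * X 2 := by
    simp only [map_add, Derivation.leibniz, Derivation.leibniz_pow, pderiv_X_self, smul_eq_mul, nsmul_eq_mul,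
      pderiv_X_of_ne (show (0 : Fin 3) ≠ 2 by decide), pderiv_X_of_ne (show (1 : Fin 3) ≠ 2 by decide)]
    push_cast; ring
  have d20 : pderiv 0 (X 0 ^ 2 * X 1 + X 1 ^ 2 + X 2 + X 0 * X 2 ^ 2 : MvPolynomial (Fin 3) k) = 2 * X 0 * X 1 + X 2 ^ 2 := by
    simp only [map_add, Derivation.leibniz, Derivation.leibniz_pow, pderiv_X_self, smul_eq_mul, nsmul_eq_mul,
      pderiv_X_of_ne (show (1 : Fin 3) ≠ 0 by decide), pderiv_X_of_ne (show (2 : Fin 3) ≠ 0 by decide)]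
    push_cast; ring
  have d21 : pderiv 1 (X 0 ^ 2 * X 1 + X 1 ^ 2 + X 2 + X 0 * X 2 ^ 2 : MvPolynomial (Fin 3) k) = X 0 ^ 2 + 2 * X 1 := by
    simp only [map_add, Derivation.leibniz, Derivation.leibniz_pow, pderiv_X_self, smul_eq_mul, nsmul_eq_mul,
      pderiv_X_of_ne (show (0 : Fin 3) ≠ 1 by decide), pderiv_X_of_ne (show (2 : Fin 3) ≠ 1 by decide)]
    push_cast; ring
  have d22 : pderiv 2 (X 0 ^ 2 * X 1 + X 1 ^ 2 + X 2 + X 0 * X 2 ^ 2 : MvPolynomial (Fin 3) k) = 1 + 2 * X 0 * X 2 := by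
    simp only [map_add, Derivation.leibniz, Derivation.leibniz_pow, pderiv_X_self, smul_eq_mul, nsmul_eq_mul,
      pderiv_X_of_ne (show (0 : Fin 3) ≠ 2 by decide), pderiv_X_of_ne (show (1 : Fin 3) ≠ 2 by decide)]
    push_cast; ring
  obtain rfl | rfl | rfl | rfl : a = 0 ∨ a = 1 ∨ a = 2 ∨ a = 3 := by fin_cases a <;> simp
  · change (X 0 + X 0 ^ 2 * X 1 + X 1 ^ 2 * X 2 + X 2 ^ 2 : MvPolynomial (Fin 3) k) ∈ Q at hQa
    change ∃ D : Derivation k (MvPolynomial (Fin 3) k) (MvPolynomial (Fin 3) k), D (X 0 + X 0 ^ 2 * X 1 + X 1 ^ 2 * X 2 + X 2 ^ 2 : MvPolynomial (Fin 3) k) ∉ Q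
    exact X2CubicFormSmoothCert.smooth_of_jacobian_certificate k _ (X 1) 1 (-(X 1 ^ 2)) (X 1 * X 2)
      (by rw [d00, d01, d02]; linear_combination (X 0 * X 1 + X 1 * X 2 ^ 2 : MvPolynomial (Fin 3) k) * h3) Q hQ hQa
  · change (X 0 ^ 2 + X 1 + X 1 ^ 2 * X 2 + X 0 * X 2 ^ 2 : MvPolynomial (Fin 3) k) ∈ Q at hQa
    change ∃ D : Derivation k (MvPolynomial (Fin 3) k) (MvPolynomial (Fin 3) k), D (X 0 ^ 2 + X 1 + X 1 ^ 2 * X 2 + X 0 * X 2 ^ 2 : MvPolynomial (Fin 3) k) ∉ Q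
    exact X2CubicFormSmoothCert.smooth_of_jacobian_certificate k _ (X 2) (X 2 * X 0) 1 (-(X 2 ^ 2))
      (by rw [d10, d11, d12]; linear_combination (X 0 ^ 2 * X 2 + X 1 * X 2 : MvPolynomial (Fin 3) k) * h3) Q hQ hQa
  · change (X 0 ^ 2 * X 1 + X 1 ^ 2 + X 2 + X 0 * X 2 ^ 2 : MvPolynomial (Fin 3) k) ∈ Q at hQa
    change ∃ D : Derivation k (MvPolynomial (Fin 3) k) (MvPolynomial (Fin 3) k), D (X 0 ^ 2 * X 1 + X 1 ^ 2 + X 2 + X 0 * X 2 ^ 2 : MvPolynomial (Fin 3) k) ∉ Q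
    exact X2CubicFormSmoothCert.smooth_of_jacobian_certificate k _ (X 0) (-(X 0 ^ 2)) (X 0 * X 1) 1
      (by rw [d20, d21, d22]; linear_combination (X 0 * X 2 + X 0 * X 1 ^ 2 : MvPolynomial (Fin 3) k) * h3) Q hQ hQa
  · change (X 0 + X 0 ^ 2 * X 1 + X 1 ^ 2 * X 2 + X 2 ^ 2 : MvPolynomial (Fin 3) k) ∈ Q at hQa
    change ∃ D : Derivation k (MvPolynomial (Fin 3) k) (MvPolynomial (Fin 3) k), D (X 0 + X 0 ^ 2 * X 1 + X 1 ^ 2 * X 2 + X 2 ^ 2 : MvPolynomial (Fin 3) k) ∉ Q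
    exact X2CubicFormSmoothCert.smooth_of_jacobian_certificate k _ (X 1) 1 (-(X 1 ^ 2)) (X 1 * X 2)
      (by rw [d00, d01, d02]; linear_combination (X 0 * X 1 + X 1 * X 2 ^ 2 : MvPolynomial (Fin 3) k) * h3) Q hQ hQa

/-! ## §5 ★★ The rows at `p = 3`: T″-instance #4 -/

/-- ★★ **lead-1's T-side class row on the cyclic cubic at `p = 3`**: SCOPE ∧ (point floor LEGAL and FULL at every stalk) ∧ `TStepGerm.TStepInstanceAt 3 v (𝔪̃·𝒪_{Y,v})`, for every
field of characteristic 3. [OURS · instance of ✓ `tStep_row_of_doublePoint_cubicForm`] -/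
theorem cyclic_tStep_row_char3 [CharP k 3] (f : MvPolynomial (Fin 5) k)
    (hf : f = X 4 ^ 2 + rename (Fin.castSucc : Fin 4 → Fin 5) (X 0 ^ 2 * X 1 + X 1 ^ 2 * X 2 + X 2 ^ 2 * X 3 + X 3 ^ 2 * X 0 : MvPolynomial (Fin 4) k))
    (v : Spec (.of (MvPolynomial (Fin 5) k ⧸ Ideal.span {f})))
    (hv : v.asIdeal = Ideal.span (Set.range fun j : Fin 5 => Ideal.Quotient.mk (Ideal.span {f}) (X j))) :
    (IsClosed ({v} : Set (Spec (.of (MvPolynomial (Fin 5) k ⧸ Ideal.span {f})))) ∧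
      v ∉ Scheme.regularLocus (Spec (.of (MvPolynomial (Fin 5) k ⧸ Ideal.span {f}))) ∧
      ringKrullDim ((Spec (.of (MvPolynomial (Fin 5) k ⧸ Ideal.span {f}))).presheaf.stalk v) = (4 : ℕ)) ∧
    (∀ (S' : Scheme.{0}) (g : S' ⟶ Spec ((Spec (.of (MvPolynomial (Fin 5) k ⧸ Ideal.span {f}))).presheaf.stalk v)),
      IsBlowup g ((affineBlowup.idealSheaf (Ideal.span (Set.range (fun j : Fin 5 => Ideal.Quotient.mk (Ideal.span {f}) (X j))))).comap
        ((Spec (.of (MvPolynomial (Fin 5) k ⧸ Ideal.span {f}))).fromSpecStalk v)) →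
      ((affineBlowup.idealSheaf (Ideal.span (Set.range (fun j : Fin 5 => Ideal.Quotient.mk (Ideal.span {f}) (X j))))).comap
          ((Spec (.of (MvPolynomial (Fin 5) k ⧸ Ideal.span {f}))).fromSpecStalk v)) ≠ ⊥ ∧
      (((((affineBlowup.idealSheaf (Ideal.span (Set.range (fun j : Fin 5 => Ideal.Quotient.mk (Ideal.span {f}) (X j))))).comap
          ((Spec (.of (MvPolynomial (Fin 5) k ⧸ Ideal.span {f}))).fromSpecStalk v))).support :
            Set (Spec ((Spec (.of (MvPolynomial (Fin 5) k ⧸ Ideal.span {f}))).presheaf.stalk v))) ⊆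
          (Scheme.regularLocus (Spec ((Spec (.of (MvPolynomial (Fin 5) k ⧸ Ideal.span {f}))).presheaf.stalk v)))ᶜ) ∧
      (∀ s : S', g.base s ≠ closedPoint ((Spec (.of (MvPolynomial (Fin 5) k ⧸ Ideal.span {f}))).presheaf.stalk v) → s ∈ Scheme.regularLocus S') ∧
      (∀ s : S', FullCl 3 (S'.presheaf.stalk s))) ∧
    TStepGerm.TStepInstanceAt 3 v ((affineBlowup.idealSheaf (Ideal.span (Set.range fun j : Fin 5 => Ideal.Quotient.mk (Ideal.span {f}) (X j)))).comap
      ((Spec (.of (MvPolynomial (Fin 5) k ⧸ Ideal.span {f}))).fromSpecStalk v)) := by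
  haveI : Fact (Nat.Prime 3) := ⟨Nat.prime_three⟩
  have h2 : (2 : k) ≠ 0 := by
    intro h
    have h3 : (3 : k) = 0 := by exact_mod_cast CharP.cast_eq_zero k 3
    exact one_ne_zero (by linear_combination h3 - h : (1 : k) = 0)
  have h5 : (5 : k) ≠ 0 := by
    intro h
    have h3 : (3 : k) = 0 := by exact_mod_cast CharP.cast_eq_zero k 3
    exact one_ne_zero (by linear_combination (-1 : k) * h + 2 * h3 : (1 : k) = 0)
  exact X2CubicFormTStepRow.tStep_row_of_doublePoint_cubicForm k 3 _ (cyclic_isHomogeneous k) f hf (prime_f k f hf)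
    (fun P _ hP => regular_off_vertex_of_ne k h2 h5 f hf P hP) (prime_chartCubic k) (smooth_chartCubic_char3 k) v hv

/-- ★★ **T″-INSTANCE #4: the cyclic cubic at `p = 3` ON A FULL INPUT** — `𝒪_{Y,v}` is `FullCl 3` (§2) ∧ lead-1's T-side row (§5): a closed, singular, isolated, FULL point of a
non-Fermat bed in characteristic 3 whose point floor is LEGAL, FULL everywhere, and regularised by ONE blowing up along its reduced singular locus. [OURS · instance] -/
theorem cyclic_tInstance_char3 [CharP k 3] (f : MvPolynomial (Fin 5) k)
    (hf : f = X 4 ^ 2 + rename (Fin.castSucc : Fin 4 → Fin 5) (X 0 ^ 2 * X 1 + X 1 ^ 2 * X 2 + X 2 ^ 2 * X 3 + X 3 ^ 2 * X 0 : MvPolynomial (Fin 4) k))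
    (v : Spec (.of (MvPolynomial (Fin 5) k ⧸ Ideal.span {f})))
    (hv : v.asIdeal = Ideal.span (Set.range fun j : Fin 5 => Ideal.Quotient.mk (Ideal.span {f}) (X j))) :
    FullCl 3 ((Spec (.of (MvPolynomial (Fin 5) k ⧸ Ideal.span {f}))).presheaf.stalk v) ∧
    ((IsClosed ({v} : Set (Spec (.of (MvPolynomial (Fin 5) k ⧸ Ideal.span {f})))) ∧
      v ∉ Scheme.regularLocus (Spec (.of (MvPolynomial (Fin 5) k ⧸ Ideal.span {f}))) ∧
      ringKrullDim ((Spec (.of (MvPolynomial (Fin 5) k ⧸ Ideal.span {f}))).presheaf.stalk v) = (4 : ℕ)) ∧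
    (∀ (S' : Scheme.{0}) (g : S' ⟶ Spec ((Spec (.of (MvPolynomial (Fin 5) k ⧸ Ideal.span {f}))).presheaf.stalk v)),
      IsBlowup g ((affineBlowup.idealSheaf (Ideal.span (Set.range (fun j : Fin 5 => Ideal.Quotient.mk (Ideal.span {f}) (X j))))).comap
        ((Spec (.of (MvPolynomial (Fin 5) k ⧸ Ideal.span {f}))).fromSpecStalk v)) →
      ((affineBlowup.idealSheaf (Ideal.span (Set.range (fun j : Fin 5 => Ideal.Quotient.mk (Ideal.span {f}) (X j))))).comap
          ((Spec (.of (MvPolynomial (Fin 5) k ⧸ Ideal.span {f}))).fromSpecStalk v)) ≠ ⊥ ∧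
      (((((affineBlowup.idealSheaf (Ideal.span (Set.range (fun j : Fin 5 => Ideal.Quotient.mk (Ideal.span {f}) (X j))))).comap
          ((Spec (.of (MvPolynomial (Fin 5) k ⧸ Ideal.span {f}))).fromSpecStalk v))).support :
            Set (Spec ((Spec (.of (MvPolynomial (Fin 5) k ⧸ Ideal.span {f}))).presheaf.stalk v))) ⊆
          (Scheme.regularLocus (Spec ((Spec (.of (MvPolynomial (Fin 5) k ⧸ Ideal.span {f}))).presheaf.stalk v)))ᶜ) ∧
      (∀ s : S', g.base s ≠ closedPoint ((Spec (.of (MvPolynomial (Fin 5) k ⧸ Ideal.span {f}))).presheaf.stalk v) → s ∈ Scheme.regularLocus S') ∧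
      (∀ s : S', FullCl 3 (S'.presheaf.stalk s))) ∧
    TStepGerm.TStepInstanceAt 3 v ((affineBlowup.idealSheaf (Ideal.span (Set.range fun j : Fin 5 => Ideal.Quotient.mk (Ideal.span {f}) (X j)))).comap
      ((Spec (.of (MvPolynomial (Fin 5) k ⧸ Ideal.span {f}))).fromSpecStalk v))) :=
  ⟨cyclic_vertex_full_char3 k f hf v hv, cyclic_tStep_row_char3 k f hf v hv⟩

end Summit.ResolutionOfSingularities.ResolutionOfSingularities.Theorems.FInjectiveMacaulayfication.X2CyclicCubicChar3

end
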